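import Mathlib.LinearAlgebra.Matrix.SchurComplement
import Mathlib.Data.Matrix.ColumnRowPartitioned
import Mathlib.Tactic.Abel

/-!
# T-TEL (telescoping identity) line, helper 1 — THE FINITE-DIMENSIONAL SKELETON: one step = a Schur complement (response-graph congruence,
# resolvent blocks), two steps = one step (Crabtree–Haynsworth quotient formula, general form), determinants telescope

Helper for crux K2⁷ `EndpointGivenBR13SepCoPH` = stmt-QuantumFields-20543 (route `BalabanUVNodes`; D1 is K2's Track-A input), seat `d1-tel-1` gen 0,
director-ym R576-ym (D)(2) ∕ g18 (b): «(T-TEL) the telescoping identity as a THEOREM for all L ≥ 2 and all scales j (an algebraic semigroup identity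
of the quadratic jets — one step = a Schur complement, the composite = the iterated one; Haynsworth-quotient shape)».  The three signatures of the
line are the crux workfile `Cruxes/EndpointGivenBR13SepCoPH/D1TelSignatures.lean`; THIS file lands the two matrix-level ones, sorry-free, with the
corollaries a kernel-level dictionary consumes.  Everything is [folklore] block-matrix algebra over a commutative ring (Mathlib's
`Matrix.fromBlocks₂₂Invertible` ∕ `invOf_fromBlocks₂₂_eq` ∕ `det_fromBlocks₂₂` and the `fromRows`∕`fromCols` calculus); 0 `def`, 0 `sorry`.

WHAT IS PROVED (block form `M = [[A, B],[C, D]]` on (retained `α`) ⊕ (integrated `δ`); Schur complement spelled out `A − B·D⁻¹·C`):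
* §1 ONE STEP = A SCHUR COMPLEMENT.  `schur_eq_add_mul_response` (`D·W = −C` ⟹ `M/D = A + B·W`), `schur_eq_add_response_mul` (left twin,
  `V·D = −B` ⟹ `M/D = A + V·C`), `schur_eq_graph_congruence` (`[1 | V]·M·[1 ; W] = M/D` for the exact right response `W` and ANY left leg `V` —
  the two-leg «dressing» shape of `HessianTelescopingKKT.StepRecursion`); the RESOLVENT reading: `inv_toBlocks₁₁_eq_inv_schur` (the retained block
  of `M⁻¹` is `(M/D)⁻¹` — the decimated composite resolvent is the resolvent of the effective form) and `inv_toBlocks₂₁_eq_response_mul` (the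
  integrated-to-retained block of `M⁻¹` is `W·(M/D)⁻¹`, `W = −D⁻¹C` — the response column through which the next step transports; cf. the
  `ℋ`-column weight `HessianTelescopingKKT.wStep`).
* §2 TWO STEPS = ONE STEP.  `schur_quotient` — the Crabtree–Haynsworth QUOTIENT FORMULA in general form (any commutative ring, NONSINGULAR nested
  pivots; three levels `α ⊕ β ⊕ γ`): `M/D = (M/D₂₂)/(D/D₂₂)` with every block displayed — the `TODO(general form)` recorded in
  `Literature/MathematicalPhysics/PowerSystems/KronReductionQuotientProperty` (there: symmetric, positive definite pivot, by the Dirichlet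
  principle); `det_fromBlocks_of_isUnit` (`det M = det D · det(M/D)`, `IsUnit` form of Mathlib's `det_fromBlocks₂₂`), `isUnit_det_fromBlocks_of_isUnit`,
  and `det_three_levels` (`det M = det D₂₂ · det(D/D₂₂) · det((M/D₂₂)/(D/D₂₂))` — the Gaussian normalisations of two successive steps and of the
  one-shot step TELESCOPE; `Literature…Beta.Composition.Chain.logZ_total` is the constrained (bordered) `k`-fold version already in the tree).
* §3 ALONG A BACKGROUND: `schur_quotient_pointwise` — for block FAMILIES `s ↦ M(s)` the two-stage and one-shot effective forms agree AS FUNCTIONS on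
  the set where the pivots are non-degenerate, hence so do all their jets (derivatives in `s`) — the «quadratic jets telescope» sentence at matrix level.

HONEST FRAMING.  Textbook linear algebra, kernel-checked; NOT the kernel-level dictionary (signature (S3) `StubDictionary` of the memo = the tree predicate
`TshotOf Lc Jc 1 = TbalOf Lc Js 0 ∧ StepRecursion Lc (TbalOf Lc Js) (TshotOf Lc Jc) (wStep Lc)`, LAYER 2 of the β sub-cell's node P6 for Bałaban's rooted jets,
road «FP» route T — OPEN); nothing of Bałaban's analysis is asserted; `D1Tel`, K2⁷, `BetaPertH` NOT proved; finite lattices only; NOT continuum, NOT OS,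
NOT Clay; the Yang–Mills mass gap is NOT proved.  Sources (orientation, nothing load-bearing): R. A. Horn, C. R. Johnson, *Matrix Analysis* (2nd ed.,
CUP 2013) §0.8.5 (0.8.5.12) «quotient property of Schur complements»; F. Zhang (ed.), *The Schur Complement and Its Applications* (Springer 2005)
Thm 1.4 (Crabtree–Haynsworth); T. Bałaban, CMP **109** (1987) p. 255 (0.19), p. 264 (1.20)–(1.22) (the iterated renormalization transformations whose
Gaussian part this algebra organises).
-/

namespace Summit.QuantumFields.YangMills.Theorems.BalabanUVNodesK2D1TelSchurQuotient

open Matrix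

variable {𝕜 : Type*} [CommRing 𝕜]
variable {α β γ δ : Type*} [Fintype α] [Fintype β] [Fintype γ] [Fintype δ]
  [DecidableEq α] [DecidableEq β] [DecidableEq γ] [DecidableEq δ]

/-! ## §1 One step = a Schur complement -/

omit [Fintype α] [DecidableEq α] in
/-- [folklore] **ONE STEP = A SCHUR COMPLEMENT, right-response form.**  If `W` is the exact response of the integrated block (`D·W = −C`,
`D` non-degenerate) then `M/D = A − B·D⁻¹·C = A + B·W`. -/
theorem schur_eq_add_mul_response (A : Matrix α α 𝕜) (B : Matrix α δ 𝕜) (C : Matrix δ α 𝕜) (D : Matrix δ δ 𝕜)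
    (hD : IsUnit D.det) (W : Matrix δ α 𝕜) (hW : D * W = -C) :
    A - B * D⁻¹ * C = A + B * W := by
  have hW' : W = -(D⁻¹ * C) := by
    calc W = D⁻¹ * D * W := by rw [Matrix.nonsing_inv_mul D hD, Matrix.one_mul]
    _ = D⁻¹ * (D * W) := by rw [Matrix.mul_assoc]
    _ = -(D⁻¹ * C) := by rw [hW, Matrix.mul_neg]
  rw [hW', Matrix.mul_neg, ← Matrix.mul_assoc, sub_eq_add_neg]

omit [Fintype α] [DecidableEq α] in
/-- [folklore] **ONE STEP = A SCHUR COMPLEMENT, left-response form.**  If `V` is the exact left response (`V·D = −B`, `D` non-degenerate) then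
`M/D = A − B·D⁻¹·C = A + V·C`. -/
theorem schur_eq_add_response_mul (A : Matrix α α 𝕜) (B : Matrix α δ 𝕜) (C : Matrix δ α 𝕜) (D : Matrix δ δ 𝕜)
    (hD : IsUnit D.det) (V : Matrix α δ 𝕜) (hV : V * D = -B) :
    A - B * D⁻¹ * C = A + V * C := by
  have hV' : V = -(B * D⁻¹) := by
    calc V = V * (D * D⁻¹) := by rw [Matrix.mul_nonsing_inv D hD, Matrix.mul_one]
    _ = V * D * D⁻¹ := by rw [Matrix.mul_assoc]
    _ = -(B * D⁻¹) := by rw [hV, Matrix.neg_mul]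
  rw [hV', Matrix.neg_mul, sub_eq_add_neg]

/-- [folklore] **ONE STEP = THE CONGRUENCE OF THE FULL FORM BY THE RESPONSE GRAPH (two legs).**  For the exact right response `W` (`D·W = −C`)
and ANY left leg `V` (in use: the left response, `V = Wᵀ` in the symmetric case): `[1 | V] · M · [1 ; W] = M/D`.  The lower block of `M·[1 ; W]`
vanishes (stationarity of the integrated variables), so the left dressing only reads the retained block — the matrix shape of the two-leg transport
`DressedMomentNormalisation.dressedEntry` of `HessianTelescopingKKT.StepRecursion`. -/
theorem schur_eq_graph_congruence (A : Matrix α α 𝕜) (B : Matrix α δ 𝕜) (C : Matrix δ α 𝕜) (D : Matrix δ δ 𝕜)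
    (hD : IsUnit D.det) (W : Matrix δ α 𝕜) (hW : D * W = -C) (V : Matrix α δ 𝕜) :
    fromCols (1 : Matrix α α 𝕜) V * fromBlocks A B C D * fromRows (1 : Matrix α α 𝕜) W = A - B * D⁻¹ * C := by
  rw [Matrix.mul_assoc, fromBlocks_mul_fromRows, fromCols_mul_fromRows, hW, Matrix.mul_one, Matrix.mul_one, add_neg_cancel,
    Matrix.mul_zero, add_zero, Matrix.one_mul, schur_eq_add_mul_response A B C D hD W hW]

/-- [folklore] **RESOLVENT READING, retained block**: if `D` and `M/D` are non-degenerate, the retained block of the full inverse is the inverse of the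
one-step effective form, `(M⁻¹)₁₁ = (A − B·D⁻¹·C)⁻¹` (the decimated composite resolvent is the resolvent of the effective form). -/
theorem inv_toBlocks₁₁_eq_inv_schur (A : Matrix α α 𝕜) (B : Matrix α δ 𝕜) (C : Matrix δ α 𝕜) (D : Matrix δ δ 𝕜)
    (hD : IsUnit D.det) (hS : IsUnit (A - B * D⁻¹ * C).det) :
    ((fromBlocks A B C D)⁻¹).toBlocks₁₁ = (A - B * D⁻¹ * C)⁻¹ := by
  letI : Invertible D := invertibleOfIsUnitDet _ hD
  have hS' : A - B * D⁻¹ * C = A - B * ⅟D * C := by rw [invOf_eq_nonsing_inv]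
  letI : Invertible (A - B * ⅟D * C) := (invertibleOfIsUnitDet _ hS).copy _ hS'.symm
  letI : Invertible (fromBlocks A B C D) := fromBlocks₂₂Invertible _ _ _ _
  rw [← invOf_eq_nonsing_inv (fromBlocks A B C D), invOf_fromBlocks₂₂_eq, toBlocks_fromBlocks₁₁]
  simp only [invOf_eq_nonsing_inv]

/-- [folklore] **RESOLVENT READING, response column**: under the same non-degeneracy, the integrated-to-retained block of the full inverse is the
response followed by the effective resolvent, `(M⁻¹)₂₁ = −D⁻¹·C·(A − B·D⁻¹·C)⁻¹ = W·(M/D)⁻¹` (the column through which the next step transports;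
cf. `HessianTelescopingKKT.wStep`, the renormalised `ℋ`-column of `OneStepKernelFamily.KInvStep`). -/
theorem inv_toBlocks₂₁_eq_response_mul (A : Matrix α α 𝕜) (B : Matrix α δ 𝕜) (C : Matrix δ α 𝕜) (D : Matrix δ δ 𝕜)
    (hD : IsUnit D.det) (hS : IsUnit (A - B * D⁻¹ * C).det) :
    ((fromBlocks A B C D)⁻¹).toBlocks₂₁ = -(D⁻¹ * C * (A - B * D⁻¹ * C)⁻¹) := by
  letI : Invertible D := invertibleOfIsUnitDet _ hD
  have hS' : A - B * D⁻¹ * C = A - B * ⅟D * C := by rw [invOf_eq_nonsing_inv]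
  letI : Invertible (A - B * ⅟D * C) := (invertibleOfIsUnitDet _ hS).copy _ hS'.symm
  letI : Invertible (fromBlocks A B C D) := fromBlocks₂₂Invertible _ _ _ _
  rw [← invOf_eq_nonsing_inv (fromBlocks A B C D), invOf_fromBlocks₂₂_eq, toBlocks_fromBlocks₂₁]
  simp only [invOf_eq_nonsing_inv]

/-! ## §2 Two steps = one step: the quotient formula and the telescoping of determinants -/

omit [Fintype α] [DecidableEq α] in
/-- [folklore] **THE CRABTREE–HAYNSWORTH QUOTIENT FORMULA, general form** (any commutative ring; nested pivots `D₂₂` and `D/D₂₂ = D₁₁ − D₁₂D₂₂⁻¹D₂₁`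
NON-SINGULAR).  Three levels — retained `α`, first-integrated `β`, second-integrated `γ`; `M = [[A, B₁, B₂],[C₁, D₁₁, D₁₂],[C₂, D₂₁, D₂₂]]`,
`D = [[D₁₁, D₁₂],[D₂₁, D₂₂]]`.  Eliminating `γ` and then `β` equals eliminating `β ⊕ γ` at once: `M/D = (M/D₂₂)/(D/D₂₂)`, every block displayed
(Horn–Johnson §0.8.5 (0.8.5.12); Zhang (ed.) 2005, Thm 1.4). -/
theorem schur_quotient (A : Matrix α α 𝕜) (B₁ : Matrix α β 𝕜) (B₂ : Matrix α γ 𝕜) (C₁ : Matrix β α 𝕜) (C₂ : Matrix γ α 𝕜)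
    (D₁₁ : Matrix β β 𝕜) (D₁₂ : Matrix β γ 𝕜) (D₂₁ : Matrix γ β 𝕜) (D₂₂ : Matrix γ γ 𝕜)
    (h₂₂ : IsUnit D₂₂.det) (h₁ : IsUnit (D₁₁ - D₁₂ * D₂₂⁻¹ * D₂₁).det) :
    A - fromCols B₁ B₂ * (fromBlocks D₁₁ D₁₂ D₂₁ D₂₂)⁻¹ * fromRows C₁ C₂
      = (A - B₂ * D₂₂⁻¹ * C₂)
        - (B₁ - B₂ * D₂₂⁻¹ * D₂₁) * (D₁₁ - D₁₂ * D₂₂⁻¹ * D₂₁)⁻¹ * (C₁ - D₁₂ * D₂₂⁻¹ * C₂) := by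
  letI : Invertible D₂₂ := invertibleOfIsUnitDet _ h₂₂
  have hS' : D₁₁ - D₁₂ * D₂₂⁻¹ * D₂₁ = D₁₁ - D₁₂ * ⅟D₂₂ * D₂₁ := by rw [invOf_eq_nonsing_inv]
  letI : Invertible (D₁₁ - D₁₂ * ⅟D₂₂ * D₂₁) := (invertibleOfIsUnitDet _ h₁).copy _ hS'.symm
  letI : Invertible (fromBlocks D₁₁ D₁₂ D₂₁ D₂₂) := fromBlocks₂₂Invertible _ _ _ _
  rw [← invOf_eq_nonsing_inv (fromBlocks D₁₁ D₁₂ D₂₁ D₂₂), invOf_fromBlocks₂₂_eq, fromCols_mul_fromBlocks, fromCols_mul_fromRows]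
  simp only [invOf_eq_nonsing_inv]
  generalize (D₁₁ - D₁₂ * D₂₂⁻¹ * D₂₁)⁻¹ = X
  generalize D₂₂⁻¹ = Y
  simp only [Matrix.mul_add, Matrix.add_mul, Matrix.mul_sub, Matrix.sub_mul, Matrix.mul_neg, Matrix.neg_mul, Matrix.mul_assoc]
  abel

/-- [folklore] `IsUnit` form of Mathlib's `det_fromBlocks₂₂`: `det [[A, B],[C, D]] = det D · det(A − B·D⁻¹·C)` for `D` non-degenerate — the Gaussian
normalisation of the full form is that of the integrated block times that of the one-step effective form. -/
theorem det_fromBlocks_of_isUnit (A : Matrix α α 𝕜) (B : Matrix α δ 𝕜) (C : Matrix δ α 𝕜) (D : Matrix δ δ 𝕜) (hD : IsUnit D.det) :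
    (fromBlocks A B C D).det = D.det * (A - B * D⁻¹ * C).det := by
  letI : Invertible D := invertibleOfIsUnitDet _ hD
  rw [det_fromBlocks₂₂, invOf_eq_nonsing_inv]

/-- [folklore] The full form is non-degenerate as soon as the pivot and the one-step effective form are. -/
theorem isUnit_det_fromBlocks_of_isUnit (A : Matrix α α 𝕜) (B : Matrix α δ 𝕜) (C : Matrix δ α 𝕜) (D : Matrix δ δ 𝕜)
    (hD : IsUnit D.det) (hS : IsUnit (A - B * D⁻¹ * C).det) : IsUnit (fromBlocks A B C D).det := by
  rw [det_fromBlocks_of_isUnit A B C D hD]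
  exact hD.mul hS

/-- [folklore] **DETERMINANTS TELESCOPE OVER TWO STEPS**: with the nested pivots `D₂₂`, `D/D₂₂` non-degenerate,
`det M = det D₂₂ · det(D/D₂₂) · det((M/D₂₂)/(D/D₂₂))` — the one-shot Gaussian normalisation is the product of the two successive one-step
normalisations and that of the final effective form (the unconstrained twin of `Literature…Beta.Composition.Chain.logZ_total`). -/
theorem det_three_levels (A : Matrix α α 𝕜) (B₁ : Matrix α β 𝕜) (B₂ : Matrix α γ 𝕜) (C₁ : Matrix β α 𝕜) (C₂ : Matrix γ α 𝕜)
    (D₁₁ : Matrix β β 𝕜) (D₁₂ : Matrix β γ 𝕜) (D₂₁ : Matrix γ β 𝕜) (D₂₂ : Matrix γ γ 𝕜)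
    (h₂₂ : IsUnit D₂₂.det) (h₁ : IsUnit (D₁₁ - D₁₂ * D₂₂⁻¹ * D₂₁).det) :
    (fromBlocks A (fromCols B₁ B₂) (fromRows C₁ C₂) (fromBlocks D₁₁ D₁₂ D₂₁ D₂₂)).det
      = D₂₂.det * (D₁₁ - D₁₂ * D₂₂⁻¹ * D₂₁).det
        * ((A - B₂ * D₂₂⁻¹ * C₂)
            - (B₁ - B₂ * D₂₂⁻¹ * D₂₁) * (D₁₁ - D₁₂ * D₂₂⁻¹ * D₂₁)⁻¹ * (C₁ - D₁₂ * D₂₂⁻¹ * C₂)).det := by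
  have hD : IsUnit (fromBlocks D₁₁ D₁₂ D₂₁ D₂₂).det := isUnit_det_fromBlocks_of_isUnit D₁₁ D₁₂ D₂₁ D₂₂ h₂₂ h₁
  rw [det_fromBlocks_of_isUnit _ _ _ _ hD, det_fromBlocks_of_isUnit D₁₁ D₁₂ D₂₁ D₂₂ h₂₂,
    schur_quotient A B₁ B₂ C₁ C₂ D₁₁ D₁₂ D₂₁ D₂₂ h₂₂ h₁]

/-! ## §3 Along a background: the two-stage and one-shot effective forms agree as functions, hence jet by jet -/

omit [Fintype α] [DecidableEq α] in
/-- [folklore] **THE QUADRATIC JETS TELESCOPE (matrix level).**  For block FAMILIES over any parameter set `S` (a background field, a curve `s ↦ M(s)`, …)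
whose nested pivots are non-degenerate at every parameter, the two-stage effective form and the one-shot effective form are THE SAME FUNCTION of the
parameter — so every jet (derivative, difference quotient, Taylor coefficient in `s`) of the one is that of the other. -/
theorem schur_quotient_pointwise {S : Type*} (A : S → Matrix α α 𝕜) (B₁ : S → Matrix α β 𝕜) (B₂ : S → Matrix α γ 𝕜)
    (C₁ : S → Matrix β α 𝕜) (C₂ : S → Matrix γ α 𝕜) (D₁₁ : S → Matrix β β 𝕜) (D₁₂ : S → Matrix β γ 𝕜) (D₂₁ : S → Matrix γ β 𝕜)
    (D₂₂ : S → Matrix γ γ 𝕜) (h₂₂ : ∀ s, IsUnit (D₂₂ s).det) (h₁ : ∀ s, IsUnit (D₁₁ s - D₁₂ s * (D₂₂ s)⁻¹ * D₂₁ s).det) :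
    (fun s => A s - fromCols (B₁ s) (B₂ s) * (fromBlocks (D₁₁ s) (D₁₂ s) (D₂₁ s) (D₂₂ s))⁻¹ * fromRows (C₁ s) (C₂ s))
      = fun s => (A s - B₂ s * (D₂₂ s)⁻¹ * C₂ s)
          - (B₁ s - B₂ s * (D₂₂ s)⁻¹ * D₂₁ s) * (D₁₁ s - D₁₂ s * (D₂₂ s)⁻¹ * D₂₁ s)⁻¹ * (C₁ s - D₁₂ s * (D₂₂ s)⁻¹ * C₂ s) :=
  funext fun s => schur_quotient _ _ _ _ _ _ _ _ _ (h₂₂ s) (h₁ s)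

end Summit.QuantumFields.YangMills.Theorems.BalabanUVNodesK2D1TelSchurQuotient
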